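import Summits.Ventures.CertifiedQuantumChemistry.Certificates.HubbardRingL4U1DQGGapTables
import HarnessLib

/-!
# Ventures/CertifiedQuantumChemistry — Certificates/HubbardRingL4U1DQGGapQ.lean: the `Q`-condition kernel run of the
# `U = 1` strict-gap certificate of the half-filled Hubbard 4-ring (data in `…GapTables.lean`, theorems in `…Gap.lean`)

HONEST FRAMING (verbatim): certified bounds for a stated model Hamiltonian in a stated basis; not a
claim about the real molecule beyond that model.

Seat rdm-B (data: gen 40's kit job `j280753`; drafted by gen 40, farm-checked and filed by gen 41). One kernel statement (split out so that every file elaborates well within the farm's wall limit): the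
precomputed integer table `gapL4U1Qz/den` IS Mazziotti's `Q`-map of the pair (all entries, kernel evaluation), and it is
symmetric and ACCEPTED by `ExactLDL.ldlAccept` (rank `28`). 0 sorry, 0 def.
-/

namespace Summit.Ventures.CertifiedQuantumChemistry

namespace DQGGap

/-- The precomputed table IS the `Q`-map of the pair (all `64 × 64` entries, kernel evaluation). -/
theorem ringL4U1_Q_tab :
    toFin (qMapQ (gamQ gapL4U1den gapL4U1g) (GamQ gapL4U1den gapL4U1G)) = toFin (GamQ gapL4U1den gapL4U1Qz) := by
  decide +kernel

/-- `Q`-condition by the kernel: `Q(γ, Γ)` is symmetric and ACCEPTED by the exact `LDLᵀ` routine (rank `28`). -/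
theorem ringL4U1_ldl_Q :
    (toFin (qMapQ (gamQ gapL4U1den gapL4U1g) (GamQ gapL4U1den gapL4U1G))).IsSymm ∧
      ExactLDL.ldlAccept (4 * 2 * (4 * 2)) (toFin (qMapQ (gamQ gapL4U1den gapL4U1g) (GamQ gapL4U1den gapL4U1G))) = true := by
  rw [ringL4U1_Q_tab]
  constructor <;> decide +kernel

end DQGGap

end Summit.Ventures.CertifiedQuantumChemistry
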